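/-
Fleet lead `ym-wcr-19609-p1` (seat prover-ym-wcr-19609-p1-g2-0), route `WeakCouplingRates`, crux `BulkDominatesColdBoxW`
(stmt-QuantumFields-19609), line `dlr-chessboard` (v6): the interface plaquettes (near the box centre) have all their links in the cold box.
-/
import Summits.QuantumFields.YangMills.Theorems.WeakCouplingRatesBulkDominatesColdBoxWKernelTransport
import Summits.QuantumFields.YangMills.Theorems.WeakCouplingRatesBulkDominatesColdBoxWMeanSmoothOfExpansion

/-!
# Crux `BulkDominatesColdBoxW`, expansion stubs: the plaquettes of the interfaces are BOX-LOCAL, so the transport `ω ↦` truncated gauge copy applies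

`KernelMeanExpansion` quantifies over sites `x` with `8|x_m − H| ≤ H`; `KernelCovExpansion` uses the centre pair `p_c = (boxCentre H;1,2)`,
`p_c + ⌈β^A⌉e₀`.  For `H ≥ 1` all four links of such a plaquette lie in the cold box `Λ = boxEdges 4 (2H+1)` (`near_centre_plaquette_edges_mem`),
so `integral_plaqCostAt(_mul)_boxKernel_eq_trunc_gauge` (`…KernelTransport`) give: the kernel mean of `c_x` and the kernel two-point function of
`c_p, c_q` at the crude-good datum `ω` equal those at its truncated gauge copy (`integral_plaqCostAt_boxKernel_eq_trunc_gauge_of_near_centre`,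
`integral_plaqCostAt_mul_boxKernel_eq_trunc_gauge_of_near_centre`); the centre pair is near the centre when `8⌈β^A⌉ ≤ H` (`near_centre_of_le`).
No new definition; standard axioms.  NOT a claim about the mass gap.
-/

set_option autoImplicit false

noncomputable section

open MeasureTheory Finset
open Literature.Probability.LatticeModels Literature.MathematicalPhysics.QuantumLattice
open Literature.MathematicalPhysics.QuantumFieldTheory Literature.MathematicalPhysics.QuantumFieldTheory.AxialGauge
open Literature.MathematicalPhysics.QuantumFieldTheory.LatticeMaxwell

namespace Summit.QuantumFields.YangMills.Theorems.WeakCouplingRates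

/-- **Near-centre plaquettes are box plaquettes**: if `8|x_m − H| ≤ H` for all `m` (and `H ≥ 1`, `i ≠ j`) then the four links of the plaquette
`(x; i, j)` lie in `boxEdges 4 (2H+1)`. -/
theorem near_centre_plaquette_edges_mem {H : ℕ} (hH : 1 ≤ H) {x : Site 4} (hx : ∀ m : Fin 4, 8 * |x m - (H : ℤ)| ≤ (H : ℤ)) {i j : Fin 4}
    (hij : i ≠ j) :
    (x, i) ∈ boxEdges 4 (2 * H + 1) ∧ (x + Pi.single i 1, j) ∈ boxEdges 4 (2 * H + 1) ∧
      (x + Pi.single j 1, i) ∈ boxEdges 4 (2 * H + 1) ∧ (x, j) ∈ boxEdges 4 (2 * H + 1) := by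
  have hb : ∀ m : Fin 4, 7 * (H : ℤ) ≤ 8 * x m ∧ 8 * x m ≤ 9 * (H : ℤ) := fun m => by
    have h := hx m
    rw [show 8 * |x m - (H : ℤ)| = |8 * x m - 8 * (H : ℤ)| by
      rw [show 8 * x m - 8 * (H : ℤ) = 8 * (x m - H) by ring, abs_mul]; norm_num] at h
    obtain ⟨h1, h2⟩ := abs_le.1 h
    constructor <;> omega
  have hH' : (1 : ℤ) ≤ H := by exact_mod_cast hH
  have hs : ∀ (k l : Fin 4), (x + Pi.single k (1 : ℤ) : Site 4) l = x l + (if l = k then 1 else 0) := fun k l => by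
    simp only [Pi.add_apply, Pi.single_apply]
  have hn : ((2 * H + 1 : ℕ) : ℤ) = 2 * (H : ℤ) + 1 := by push_cast; ring
  refine ⟨?_, ?_, ?_, ?_⟩
  · rw [mem_boxEdges_iff]
    refine ⟨fun k => ?_, ?_⟩
    · have := hb k; rw [hn]; constructor <;> omega
    · have := hb i; rw [hn]; omega
  · rw [mem_boxEdges_iff]
    refine ⟨fun k => ?_, ?_⟩
    · have := hb k; rw [hn, hs]; split_ifs <;> constructor <;> omega
    · have := hb j; rw [hn, hs, if_neg hij.symm]; omega
  · rw [mem_boxEdges_iff]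
    refine ⟨fun k => ?_, ?_⟩
    · have := hb k; rw [hn, hs]; split_ifs <;> constructor <;> omega
    · have := hb i; rw [hn, hs, if_neg hij]; omega
  · rw [mem_boxEdges_iff]
    refine ⟨fun k => ?_, ?_⟩
    · have := hb k; rw [hn]; constructor <;> omega
    · have := hb j; rw [hn]; omega

/-- **Transport of the kernel mean of a near-centre plaquette cost** to the truncated gauge copy of the datum. -/
theorem integral_plaqCostAt_boxKernel_eq_trunc_gauge_of_near_centre (β : ℝ) {H : ℕ} (hH : 1 ≤ H)
    (ω : LGConfig 4 (Matrix.specialUnitaryGroup (Fin 2) ℂ)) (g : Site 4 → Matrix.specialUnitaryGroup (Fin 2) ℂ)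
    {x : Site 4} (hx : ∀ m : Fin 4, 8 * |x m - (H : ℤ)| ≤ (H : ℤ)) {i j : Fin 4} (hij : i ≠ j) :
    ∫ U, plaqCostAt (fundamentalRep (Fin 2)) x i j U ∂(boxKernel β H ω) =
      ∫ U, plaqCostAt (fundamentalRep (Fin 2)) x i j U ∂(boxKernel β H (glueWith (boxEdgesAt dirCorner (2 * H + 3))
        (fun e' : ↥(boxEdgesAt dirCorner (2 * H + 3)) => gaugeTransformZd g ω e'.1) (fun _ => 1))) := by
  obtain ⟨h1, h2, h3, h4⟩ := near_centre_plaquette_edges_mem hH hx hij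
  exact integral_plaqCostAt_boxKernel_eq_trunc_gauge β H ω g h1 h2 h3 h4

/-- **Transport of the kernel two-point integral of two near-centre plaquette costs.** -/
theorem integral_plaqCostAt_mul_boxKernel_eq_trunc_gauge_of_near_centre (β : ℝ) {H : ℕ} (hH : 1 ≤ H)
    (ω : LGConfig 4 (Matrix.specialUnitaryGroup (Fin 2) ℂ)) (g : Site 4 → Matrix.specialUnitaryGroup (Fin 2) ℂ)
    {x y : Site 4} (hx : ∀ m : Fin 4, 8 * |x m - (H : ℤ)| ≤ (H : ℤ)) (hy : ∀ m : Fin 4, 8 * |y m - (H : ℤ)| ≤ (H : ℤ))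
    {i j k l : Fin 4} (hij : i ≠ j) (hkl : k ≠ l) :
    ∫ U, plaqCostAt (fundamentalRep (Fin 2)) x i j U * plaqCostAt (fundamentalRep (Fin 2)) y k l U ∂(boxKernel β H ω) =
      ∫ U, plaqCostAt (fundamentalRep (Fin 2)) x i j U * plaqCostAt (fundamentalRep (Fin 2)) y k l U
        ∂(boxKernel β H (glueWith (boxEdgesAt dirCorner (2 * H + 3))
          (fun e' : ↥(boxEdgesAt dirCorner (2 * H + 3)) => gaugeTransformZd g ω e'.1) (fun _ => 1))) := by
  obtain ⟨h1, h2, h3, h4⟩ := near_centre_plaquette_edges_mem hH hx hij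
  obtain ⟨h1', h2', h3', h4'⟩ := near_centre_plaquette_edges_mem hH hy hkl
  exact integral_plaqCostAt_mul_boxKernel_eq_trunc_gauge β H ω g h1 h2 h3 h4 h1' h2' h3' h4'

/-- The centre pair of `KernelCovExpansion` is near the centre as soon as `8T ≤ H`: both `boxCentre H` and `boxCentre H + T e₀`. -/
theorem centre_pair_near_centre {H T : ℕ} (hT : 8 * T ≤ H) :
    (∀ m : Fin 4, 8 * |(boxCentre H : Site 4) m - (H : ℤ)| ≤ (H : ℤ)) ∧
      ∀ m : Fin 4, 8 * |(boxCentre H + Pi.single 0 (T : ℤ) : Site 4) m - (H : ℤ)| ≤ (H : ℤ) := by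
  refine ⟨fun m => ?_, near_centre_of_le hT le_rfl⟩
  have h := near_centre_of_le hT (Nat.zero_le T) m
  simpa using h

end Summit.QuantumFields.YangMills.Theorems.WeakCouplingRates

end
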